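import Mathlib
import Summits.Ventures.HodgeRepro.Tier4.Common.FundamentalDomainSaturation

/-!
# Tier4/Common/DiscreteImage — a discrete subgroup meets compacts in finite sets; its image under a proper
homomorphism is discrete and meets compacts in finite sets

Blind re-derivation cell `pub-hodge-repro`, Tier 4 (README §9–§10), seat t4-typer-2 (gen 4).  Target tree path
`lean/Summits/Ventures/HodgeRepro/Tier4/Common/DiscreteImage.lean`.  Imports: Mathlib and
`Common.FundamentalDomainSaturation` (`discreteTopology_of_finite_inter_nhds`, p695146).

WHY (plan-4 g3, bus S14455 Part 6 (ii): the CM input `CentreFinFinite W` — «the image of `Z(k)` in `T_f` meets a compact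
open subgroup in a finite set», priced as C-L4-CMUNITS «via Mathlib's `NumberField.Units.rank`, a real cut, later»).
No unit theorem is needed for this input once the ARCHIMEDEAN TORUS IS COMPACT: `Z(k)` is a discrete subgroup of
`T(𝔸)` (L1's `rationalOf_discrete`), `T(𝔸) ≃ T_∞ × T_f` (`torusSplit`), and when `T_∞` is compact the projection
`p : T(𝔸) → T_f` is PROPER (`p⁻¹(K) ≃ T_∞ × K` compact for `K` compact).  Then
* a discrete subgroup of a Hausdorff group is closed (Mathlib `Subgroup.isClosed_of_discrete`), so it meets every
  compact set in a compact discrete, hence FINITE, set (`finite_inter_of_discrete_of_isCompact`);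
* `Γ.map p ∩ K ⊆ p '' (Γ ∩ p⁻¹ K)` is finite for every compact `K` (`finite_map_inter_of_isCompact_preimage`) —
  this is `CentreFinFinite` at any compact open `K ≤ T_f`;
* with a compact neighbourhood of `1` in a locally compact `H`, the image is DISCRETE
  (`discreteTopology_map_of_isCompact_preimage`, through `discreteTopology_of_finite_inter_nhds`) — Part 6 (iii)
  without passing through `CentreFinFinite`.
The compactness of `T_∞` for the row planes at real CM places is the companion module
`Common/TorusInfCompact.lean` (all infinite places at once, the box argument of `LocalTorusCompact`).  The
counter-model of crit-1 (`k = ℚ(√2)`, `E′ = k(√(−√2))`, a non-CM place) has a NON-compact `T_∞`, consistent with the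
input failing there.

Nothing here says anything about the status of the Hodge conjecture for CM abelian varieties, which is NOT proved
(HC_CM is NOT proved by anyone in this repository).
-/

set_option autoImplicit false

noncomputable section

namespace Summit.Ventures.HodgeRepro.Tier4.Common

open Set Filter Topology

section DiscreteInter

variable {G : Type*} [Group G] [TopologicalSpace G] [IsTopologicalGroup G] [T2Space G]

/-- **A discrete subgroup of a Hausdorff group meets every compact set in a finite set**: the subgroup is closed
(`Subgroup.isClosed_of_discrete`), so the intersection is compact, and it is discrete as a subset of `Γ`. -/
theorem finite_inter_of_discrete_of_isCompact (Γ : Subgroup G) [DiscreteTopology Γ] {L : Set G}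
    (hL : IsCompact L) : ((Γ : Set G) ∩ L).Finite := by
  have hc : IsCompact ((Γ : Set G) ∩ L) := hL.inter_left Subgroup.isClosed_of_discrete
  have hd : IsDiscrete (Γ : Set G) := SetLike.isDiscrete_iff_discreteTopology.mpr inferInstance
  exact hc.finite (hd.mono Set.inter_subset_left)

end DiscreteInter

section Image

variable {G H : Type*} [Group G] [TopologicalSpace G] [IsTopologicalGroup G] [T2Space G]
  [Group H] [TopologicalSpace H]

omit [TopologicalSpace G] [IsTopologicalGroup G] [T2Space G] [TopologicalSpace H] in
/-- `Γ.map p ∩ K ⊆ p '' (Γ ∩ p⁻¹ K)`. -/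
theorem map_inter_subset_image_inter_preimage (Γ : Subgroup G) (p : G →* H) (K : Set H) :
    (Γ.map p : Set H) ∩ K ⊆ p '' ((Γ : Set G) ∩ p ⁻¹' K) := by
  rintro y ⟨hy, hyK⟩
  obtain ⟨x, hx, rfl⟩ := Subgroup.mem_map.mp hy
  exact ⟨x, ⟨hx, hyK⟩, rfl⟩

omit [TopologicalSpace H] in
/-- **The image of a discrete subgroup under a homomorphism with compact fibres over compacts meets `K` in a finite
set**: `Γ.map p ∩ K ⊆ p '' (Γ ∩ p⁻¹ K)` and `Γ ∩ p⁻¹ K` is finite (`finite_inter_of_discrete_of_isCompact`).  No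
continuity of `p` is used — only the compactness of `p⁻¹ K`. -/
theorem finite_map_inter_of_isCompact_preimage (Γ : Subgroup G) [DiscreteTopology Γ] (p : G →* H) {K : Set H}
    (hK : IsCompact (p ⁻¹' K)) : ((Γ.map p : Set H) ∩ K).Finite :=
  ((finite_inter_of_discrete_of_isCompact Γ hK).image p).subset (map_inter_subset_image_inter_preimage Γ p K)

/-- **The image of a discrete subgroup under a proper homomorphism into a locally compact Hausdorff group is
discrete**: a compact neighbourhood `K` of `1` in `H` meets the image in a finite set, so
`discreteTopology_of_finite_inter_nhds` applies. -/
theorem discreteTopology_map_of_isCompact_preimage [IsTopologicalGroup H] [T1Space H] [LocallyCompactSpace H]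
    (Γ : Subgroup G) [DiscreteTopology Γ] (p : G →* H)
    (hp : ∀ K : Set H, IsCompact K → IsCompact (p ⁻¹' K)) : DiscreteTopology (Γ.map p) := by
  obtain ⟨K, hKc, hK1⟩ := exists_compact_mem_nhds (1 : H)
  exact discreteTopology_of_finite_inter_nhds (Γ.map p) K hK1
    (finite_map_inter_of_isCompact_preimage Γ p (hp K hKc))

omit [Group G] [IsTopologicalGroup G] [T2Space G] [Group H] in
/-- The preimage of a compact set under the second projection of a homeomorphism `G ≃ₜ A × H` with `A` compact is
compact: `p⁻¹ K = e⁻¹ (univ ×ˢ K)`. -/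
theorem isCompact_preimage_snd_of_compactSpace {A : Type*} [TopologicalSpace A] [CompactSpace A]
    (e : G ≃ₜ A × H) {K : Set H} (hK : IsCompact K) : IsCompact ((fun g : G => (e g).2) ⁻¹' K) := by
  have h : (fun g : G => (e g).2) ⁻¹' K = e ⁻¹' (Set.univ ×ˢ K) := by
    ext g
    simp only [mem_preimage, mem_prod, mem_univ, true_and]
  rw [h]
  exact e.isCompact_preimage.mpr ((isCompact_univ : IsCompact (Set.univ : Set A)).prod hK)

end Image

end Summit.Ventures.HodgeRepro.Tier4.Common

end
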